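import Summits.Ventures.PackingBounds.Configurations.Dim22Card891Data

/-!
# The 891-point sharp configuration on `S²¹` as an explicit section of the Leech lattice: `A(22, arccos 1/4) = 891` and the ground-state energy — kernel checks, part E

Framing: lottery ticket; floor = certified bounds/negative ranges. Histogram chunks `41`–`51` of
the configuration of `Configurations/Dim22Card891Data` (see there and `Configurations/Dim22Card891`).
-/

namespace Summit.Ventures.PackingBounds.Config.Dim22Card891

open Summit.Ventures.PackingBounds.Config

set_option maxRecDepth 100000 in
/-- Kernel check (distance distribution), rows of chunk `41` against the whole configuration. -/
theorem hist_41 : histOK vecs891 table891 vecs891c41 = true := by decide +kernel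

set_option maxRecDepth 100000 in
/-- Kernel check (distance distribution), rows of chunk `42` against the whole configuration. -/
theorem hist_42 : histOK vecs891 table891 vecs891c42 = true := by decide +kernel

set_option maxRecDepth 100000 in
/-- Kernel check (distance distribution), rows of chunk `43` against the whole configuration. -/
theorem hist_43 : histOK vecs891 table891 vecs891c43 = true := by decide +kernel

set_option maxRecDepth 100000 in
/-- Kernel check (distance distribution), rows of chunk `44` against the whole configuration. -/
theorem hist_44 : histOK vecs891 table891 vecs891c44 = true := by decide +kernel

set_option maxRecDepth 100000 in
/-- Kernel check (distance distribution), rows of chunk `45` against the whole configuration. -/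
theorem hist_45 : histOK vecs891 table891 vecs891c45 = true := by decide +kernel

set_option maxRecDepth 100000 in
/-- Kernel check (distance distribution), rows of chunk `46` against the whole configuration. -/
theorem hist_46 : histOK vecs891 table891 vecs891c46 = true := by decide +kernel

set_option maxRecDepth 100000 in
/-- Kernel check (distance distribution), rows of chunk `47` against the whole configuration. -/
theorem hist_47 : histOK vecs891 table891 vecs891c47 = true := by decide +kernel

set_option maxRecDepth 100000 in
/-- Kernel check (distance distribution), rows of chunk `48` against the whole configuration. -/
theorem hist_48 : histOK vecs891 table891 vecs891c48 = true := by decide +kernel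

set_option maxRecDepth 100000 in
/-- Kernel check (distance distribution), rows of chunk `49` against the whole configuration. -/
theorem hist_49 : histOK vecs891 table891 vecs891c49 = true := by decide +kernel

set_option maxRecDepth 100000 in
/-- Kernel check (distance distribution), rows of chunk `50` against the whole configuration. -/
theorem hist_50 : histOK vecs891 table891 vecs891c50 = true := by decide +kernel

set_option maxRecDepth 100000 in
/-- Kernel check (distance distribution), rows of chunk `51` against the whole configuration. -/
theorem hist_51 : histOK vecs891 table891 vecs891c51 = true := by decide +kernel

end Summit.Ventures.PackingBounds.Config.Dim22Card891
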